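import Summits.QuantumFields.YangMills.Theorems.SwapVirialDeficitBlowUpScaling
import Summits.QuantumFields.YangMills.Theorems.SwapVirialDeficitBlowUpQuatDeficit
import Summits.QuantumFields.YangMills.Theorems.SwapVirialDeficitBlowUpLetterPaths
import HarnessLib

/-!
# The massive-mode rung at fixed `L`, brick J5 proper: the ring deficit is `C^∞` ALONG THE BLOW-UP (obligation (P), regularity half)
# (free-hands support of ⟨stmt-QuantumFields-24197⟩ `SwapVirialDeficit.SwapGluedStiffness`; consumes ✓`…BlowUpScaling` (w2 g57: `blowUpPoint`, `chartDeficit`),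
# ✓`…BlowUpQuatDeficit` (the deficit as a quaternion polynomial), ✓`…BlowUpLetterPaths` (w3 g64: the letters are `C^∞` in the blow-up parameter))

For a blow-up point `x = (a, (w, y))` NON-DEGENERATE AT `t = 0` (`a ≠ 0`, `axPart w.1.1 ≠ 0`, `axPart w.1.2 ≠ 0`, `w.2.re ≠ 0`, `(y f).re ≠ 0` for every follower
`f` — the complement is `β`-null):

* §1 the LINK QUATERNIONS of the reconstructed history `fixHistory (ringConfig χ (blowUpPoint t x))` are products of at most three factors among the leader
  quaternions `su2Quat (leaderTuple a (dil3 t w) μ)`, the follower quaternions `su2Quat (quatToSU2 (dilateIm t (y f)))`, the constants `su2Quat (χ x)` and `1`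
  (`contDiff_su2Quat_sliceZero_glue`, `contDiff_su2Quat_slice`, `contDiff_su2Quat_seamField`), hence `C^n` in `t` on all of `ℝ`;
* §2 ★★ `contDiff_quatHistory_blowUpPoint` — the whole quaternionic history is `C^n` in `t`; ★★★ `contDiff_chartDeficit_blowUpPoint` —
  `t ↦ chartDeficit L z χ (blowUpPoint t x)` is `C^n` for every `n` (✓`swapRingDeficit_eq_qDeficit` + ✓`contDiff_qDeficit`); with ✓`SwapRing.swapRingDeficit_nonneg`
  this is hypothesis `hreg` of w3 g64's ✓`BlowUp.ae_shell_hP` at every non-degenerate point: ★★ `hreg_chartDeficit_blowUpPoint`.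

Deliberately NOT here: the side-condition dichotomy `hbd` (dilated letters in the unit balls eventually, ✓`dilate_ball_iff`/✓`dilateIm_ball_iff`) and the a.e. packaging
into (hP) for `blowUpSet` — J6's frame (w2 g57) — and the explicit flat set (`chartDeficit (blowUpPoint 0 x) = 0 ↔` all signs positive), not needed by the shell.
HONEST LABEL: calculus plumbing for a plan-level fixed-`L` rung of a DRAFT line; NOT the principal small-ball limit, NOT ⟨24197⟩; the Yang–Mills mass gap is NOT proved;
no summit is proved by a line.  Seat ym-line-fcl-p3 g45 (cell ym-idea-1, free hands; item of record ⟨24085⟩ aside, untouched), `--supports stmt-QuantumFields-24197`.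
THEOREMS ONLY (0 `def`, 0 `sorry`), standard axioms; the series' local `ℍ` instances.  References: [cite: Luscher1983, §2]; [folklore].
-/

set_option autoImplicit false

noncomputable section

open MeasureTheory Quaternion Set Filter Topology
open scoped Quaternion ENNReal BigOperators ContDiff
open Literature.MathematicalPhysics.QuantumLattice
open Literature.MathematicalPhysics.QuantumFieldTheory hiding SU2
open Summit.QuantumFields.YangMills.Theorems.SwapTwistDeficit.ToronLog

attribute [local instance] Literature.Analysis.FluidPDE.Tao2016.quatMeasurableSpace
  Literature.Analysis.FluidPDE.Tao2016.quatBorelSpace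
  Literature.MathematicalPhysics.QuantumLattice.secondCountableTopology_su2

namespace Summit.QuantumFields.YangMills.Theorems.SwapVirialDeficit.BlowUpRing

open Summit.QuantumFields.YangMills.Theorems.FemtoTransferGap
open Summit.QuantumFields.YangMills.Theorems.FemtoTransferGap.TT
open Summit.QuantumFields.YangMills.Theorems.SwapVirialDeficit.SwapRing (swapRingDeficit swapRingDeficit_nonneg)
open Summit.QuantumFields.YangMills.Theorems.SwapVirialDeficit.ZeroModeSigma (dil3 dilateIm axPart)
open Summit.QuantumFields.YangMills.Theorems.SwapVirialDeficit.BlowUp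

variable {L : ℕ} [NeZero L]

/-! ## §1 The link quaternions along the blow-up -/

/-- The follower quaternion path with centre `1` is `C^n` (`y₀ ≠ 0`). [folklore] -/
theorem contDiff_su2Quat_follower_one {n : ℕ∞} {v : ℍ} (hv : v.re ≠ 0) :
    ContDiff ℝ n (fun t : ℝ => su2Quat (quatToSU2 (dilateIm t v))) := by
  have h := contDiff_su2Quat_follower (n := n) (p := (1 : ℍ)) (by simp) hv
  simpa only [one_mul] using h

omit [NeZero L] in
/-- The letter of an off-tree link along the blow-up is `C^n` (it is a leader quaternion or `1`). [folklore] -/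
theorem contDiff_su2Quat_letter {n : ℕ∞} {a : ℍ} {w : (ℍ × ℍ) × ℍ} (ha : a ≠ 0) (hx : axPart w.1.1 ≠ 0) (hy : axPart w.1.2 ≠ 0) (hz : w.2.re ≠ 0) (i : OffIdx L) :
    ContDiff ℝ n (fun t : ℝ => su2Quat (letter (fun μ => leaderTuple a (dil3 t w) (Fin.castSucc μ)) i)) := by
  unfold letter
  by_cases h : i.1.1 i.1.2 = -1
  · simp only [h, if_true]; exact contDiff_su2Quat_leaderTuple_dil3 ha hx hy hz _
  · simp only [h, if_false, Literature.MathematicalPhysics.QuantumFieldTheory.Balaban1983to89.T4HaarSU2Translate.su2Quat_one]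
    exact contDiff_const

omit [NeZero L] in
/-- Slice `0` along the blow-up: every glued link quaternion is `C^n`. [cite: Luscher1983, §2] -/
theorem contDiff_su2Quat_sliceZero_glue {n : ℕ∞} {a : ℍ} {w : (ℍ × ℍ) × ℍ} {y : Fol L → ℍ} (ha : a ≠ 0) (hx : axPart w.1.1 ≠ 0) (hy : axPart w.1.2 ≠ 0) (hz : w.2.re ≠ 0)
    (hf : ∀ f : Fol L, (y f).re ≠ 0) (e : Edge 3 L) :
    ContDiff ℝ n (fun t : ℝ => su2Quat (glue (sliceZero (fun μ => leaderTuple a (dil3 t w) (Fin.castSucc μ))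
      (fun i => quatToSU2 (dilateIm t (y (Sum.inl i))))) e)) := by
  by_cases he : treeEdge e = true
  · simp only [glue_apply_of_tree _ he]
    rw [show su2Quat (1 : SU2) = 1 from Literature.MathematicalPhysics.QuantumFieldTheory.Balaban1983to89.T4HaarSU2Translate.su2Quat_one]; exact contDiff_const
  · simp only [glue_apply_of_not_tree _ he]
    unfold sliceZero
    by_cases hl : isLead (⟨e, he⟩ : OffIdx L) = true
    · simp only [hl, dif_pos]
      exact contDiff_su2Quat_leaderTuple_dil3 ha hx hy hz _
    · simp only [hl]
      have e1 : (fun t : ℝ => su2Quat (letter (fun μ => leaderTuple a (dil3 t w) (Fin.castSucc μ)) ⟨e, he⟩ *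
          quatToSU2 (dilateIm t (y (Sum.inl ⟨⟨e, he⟩, hl⟩))))) =
          fun t => su2Quat (letter (fun μ => leaderTuple a (dil3 t w) (Fin.castSucc μ)) ⟨e, he⟩) * su2Quat (quatToSU2 (dilateIm t (y (Sum.inl ⟨⟨e, he⟩, hl⟩)))) :=
        funext fun t => Literature.MathematicalPhysics.QuantumFieldTheory.su2Quat_mul _ _
      simp only [Bool.not_eq_true] at hl
      simp only [Bool.false_eq_true, ↓reduceDIte]
      rw [e1]
      exact (contDiff_su2Quat_letter ha hx hy hz _).mul (contDiff_su2Quat_follower_one (hf _))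

omit [NeZero L] in
/-- The slices `1 … 2L−1` along the blow-up: every link quaternion is `C^n`. [folklore] -/
theorem contDiff_su2Quat_slice {n : ℕ∞} {a : ℍ} {w : (ℍ × ℍ) × ℍ} {y : Fol L → ℍ} (ha : a ≠ 0) (hx : axPart w.1.1 ≠ 0) (hy : axPart w.1.2 ≠ 0) (hz : w.2.re ≠ 0)
    (hf : ∀ f : Fol L, (y f).re ≠ 0) (j : Fin (2 * L - 1)) (e : Edge 3 L) :
    ContDiff ℝ n (fun t : ℝ => su2Quat (glue (sliceZero (fun μ => leaderTuple a (dil3 t w) (Fin.castSucc μ))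
      (fun i => quatToSU2 (dilateIm t (y (Sum.inl i))))) e * quatToSU2 (dilateIm t (y (Sum.inr (Sum.inl (j, e))))))) := by
  have e1 : (fun t : ℝ => su2Quat (glue (sliceZero (fun μ => leaderTuple a (dil3 t w) (Fin.castSucc μ))
      (fun i => quatToSU2 (dilateIm t (y (Sum.inl i))))) e * quatToSU2 (dilateIm t (y (Sum.inr (Sum.inl (j, e))))))) =
      fun t => su2Quat (glue (sliceZero (fun μ => leaderTuple a (dil3 t w) (Fin.castSucc μ)) (fun i => quatToSU2 (dilateIm t (y (Sum.inl i))))) e) *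
        su2Quat (quatToSU2 (dilateIm t (y (Sum.inr (Sum.inl (j, e)))))) :=
    funext fun t => Literature.MathematicalPhysics.QuantumFieldTheory.su2Quat_mul _ _
  rw [e1]
  exact (contDiff_su2Quat_sliceZero_glue ha hx hy hz hf e).mul (contDiff_su2Quat_follower_one (hf _))

omit [NeZero L] in
/-- The seam field along the blow-up: every site quaternion is `C^n`. [folklore] -/
theorem contDiff_su2Quat_seamField {n : ℕ∞} {a : ℍ} {w : (ℍ × ℍ) × ℍ} {y : Fol L → ℍ} (χ : Site 3 L → SU2) (ha : a ≠ 0) (hx : axPart w.1.1 ≠ 0) (hy : axPart w.1.2 ≠ 0) (hz : w.2.re ≠ 0)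
    (hf : ∀ f : Fol L, (y f).re ≠ 0) (s : Site 3 L) :
    ContDiff ℝ n (fun t : ℝ => su2Quat (seamField χ (leaderTuple a (dil3 t w) (Fin.last 3)) (fun v => quatToSU2 (dilateIm t (y (Sum.inr (Sum.inr v))))) s)) := by
  unfold seamField
  by_cases hs : s = 0
  · simp only [hs, dif_pos]
    exact contDiff_su2Quat_leaderTuple_dil3 ha hx hy hz _
  · simp only [hs, ↓reduceDIte]
    have e1 : (fun t : ℝ => su2Quat (χ s * leaderTuple a (dil3 t w) (Fin.last 3) * quatToSU2 (dilateIm t (y (Sum.inr (Sum.inr ⟨s, hs⟩)))))) =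
        fun t => su2Quat (χ s) * su2Quat (leaderTuple a (dil3 t w) (Fin.last 3)) * su2Quat (quatToSU2 (dilateIm t (y (Sum.inr (Sum.inr ⟨s, hs⟩))))) := by
      funext t
      rw [Literature.MathematicalPhysics.QuantumFieldTheory.su2Quat_mul, Literature.MathematicalPhysics.QuantumFieldTheory.su2Quat_mul]
    rw [e1]
    exact (contDiff_const.mul (contDiff_su2Quat_leaderTuple_dil3 ha hx hy hz _)).mul (contDiff_su2Quat_follower_one (hf _))


/-! ## §2 The quaternionic history and the deficit along the blow-up -/

/-- ★★ **The quaternionic history of the blow-up is `C^n` in the blow-up parameter** (non-degenerate point). [cite: Luscher1983, §2] -/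
theorem contDiff_quatHistory_blowUpPoint {n : ℕ∞} (χ : Site 3 L → SU2) {x : ℍ × (((ℍ × ℍ) × ℍ) × (Fol L → ℍ))}
    (ha : x.1 ≠ 0) (hx : axPart x.2.1.1.1 ≠ 0) (hy : axPart x.2.1.1.2 ≠ 0) (hz : x.2.1.2.re ≠ 0) (hf : ∀ f : Fol L, (x.2.2 f).re ≠ 0) :
    ContDiff ℝ n (fun t : ℝ =>
      ((fun i e => su2Quat ((fixHistory (ringConfig χ (blowUpPoint (L := L) t x))).1 i e),
        fun s => su2Quat ((fixHistory (ringConfig χ (blowUpPoint (L := L) t x))).2 s)) :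
          (Fin (2 * L - 1 + 1) → Edge 3 L → ℍ) × (Site 3 L → ℍ))) := by
  refine ContDiff.prodMk ?_ ?_
  · refine contDiff_pi.2 fun i => contDiff_pi.2 fun e => ?_
    refine Fin.cases ?_ (fun j => ?_) i
    · have e0 : (fun t : ℝ => su2Quat ((fixHistory (ringConfig χ (blowUpPoint (L := L) t x))).1 0 e)) =
          fun t => su2Quat (glue (sliceZero (fun μ => leaderTuple x.1 (dil3 t x.2.1) (Fin.castSucc μ))
            (fun i => quatToSU2 (dilateIm t (x.2.2 (Sum.inl i))))) e) := by
        funext t; rfl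
      rw [e0]
      exact contDiff_su2Quat_sliceZero_glue ha hx hy hz hf e
    · have ej : (fun t : ℝ => su2Quat ((fixHistory (ringConfig χ (blowUpPoint (L := L) t x))).1 j.succ e)) =
          fun t => su2Quat (glue (sliceZero (fun μ => leaderTuple x.1 (dil3 t x.2.1) (Fin.castSucc μ))
            (fun i => quatToSU2 (dilateIm t (x.2.2 (Sum.inl i))))) e * quatToSU2 (dilateIm t (x.2.2 (Sum.inr (Sum.inl (j, e)))))) := by
        funext t; rfl
      rw [ej]
      exact contDiff_su2Quat_slice ha hx hy hz hf j e
  · refine contDiff_pi.2 fun s => ?_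
    have es : (fun t : ℝ => su2Quat ((fixHistory (ringConfig χ (blowUpPoint (L := L) t x))).2 s)) =
        fun t => su2Quat (seamField χ (leaderTuple x.1 (dil3 t x.2.1) (Fin.last 3)) (fun v => quatToSU2 (dilateIm t (x.2.2 (Sum.inr (Sum.inr v))))) s) := by
      funext t; rfl
    rw [es]
    exact contDiff_su2Quat_seamField χ ha hx hy hz hf s

/-- ★★★ **THE RING DEFICIT IS `C^n` ALONG THE BLOW-UP**: at every non-degenerate blow-up point `x` and for every `n`,
`t ↦ chartDeficit L z χ (blowUpPoint t x)` is `C^n` on all of `ℝ` (✓`swapRingDeficit_eq_qDeficit` ∘ `contDiff_quatHistory_blowUpPoint`). [cite: Luscher1983, §2] -/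
theorem contDiff_chartDeficit_blowUpPoint {n : ℕ∞} (z : Fin 3 → Bool) (χ : Site 3 L → SU2) {x : ℍ × (((ℍ × ℍ) × ℍ) × (Fol L → ℍ))}
    (ha : x.1 ≠ 0) (hx : axPart x.2.1.1.1 ≠ 0) (hy : axPart x.2.1.1.2 ≠ 0) (hz : x.2.1.2.re ≠ 0) (hf : ∀ f : Fol L, (x.2.2 f).re ≠ 0) :
    ContDiff ℝ n (fun t : ℝ => chartDeficit L z χ (blowUpPoint (L := L) t x)) := by
  have e : (fun t : ℝ => chartDeficit L z χ (blowUpPoint (L := L) t x)) = fun t =>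
      qDeficit z ((fun i e => su2Quat ((fixHistory (ringConfig χ (blowUpPoint (L := L) t x))).1 i e),
        fun s => su2Quat ((fixHistory (ringConfig χ (blowUpPoint (L := L) t x))).2 s)) :
          (Fin (2 * L - 1 + 1) → Edge 3 L → ℍ) × (Site 3 L → ℍ)) := by
    funext t
    exact swapRingDeficit_eq_qDeficit z _
  rw [e]
  exact (contDiff_qDeficit (L := L) (n := n) z).comp (contDiff_quatHistory_blowUpPoint χ ha hx hy hz hf)

/-- ★★ **Hypothesis `hreg` of ✓`BlowUp.ae_shell_hP` at every non-degenerate point**: with `g x t := chartDeficit L z χ (blowUpPoint t x)`, `g x` is continuous at `0`,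
nonnegative near `0` (indeed everywhere, ✓`swapRingDeficit_nonneg`) and `C²` at `0` (unconditionally). [folklore] -/
theorem hreg_chartDeficit_blowUpPoint (z : Fin 3 → Bool) (χ : Site 3 L → SU2) {x : ℍ × (((ℍ × ℍ) × ℍ) × (Fol L → ℍ))}
    (ha : x.1 ≠ 0) (hx : axPart x.2.1.1.1 ≠ 0) (hy : axPart x.2.1.1.2 ≠ 0) (hz : x.2.1.2.re ≠ 0) (hf : ∀ f : Fol L, (x.2.2 f).re ≠ 0) :
    ContinuousAt (fun t : ℝ => chartDeficit L z χ (blowUpPoint (L := L) t x)) 0 ∧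
      (∀ᶠ t in 𝓝 (0 : ℝ), 0 ≤ chartDeficit L z χ (blowUpPoint (L := L) t x)) ∧
      (chartDeficit L z χ (blowUpPoint (L := L) 0 x) = 0 → ContDiffAt ℝ 2 (fun t : ℝ => chartDeficit L z χ (blowUpPoint (L := L) t x)) 0) := by
  have h2 : ContDiff ℝ 2 (fun t : ℝ => chartDeficit L z χ (blowUpPoint (L := L) t x)) :=
    contDiff_chartDeficit_blowUpPoint (n := 2) z χ ha hx hy hz hf
  refine ⟨h2.continuous.continuousAt, Eventually.of_forall fun t => ?_, fun _ => h2.contDiffAt⟩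
  exact swapRingDeficit_nonneg (L := L) z _

end Summit.QuantumFields.YangMills.Theorems.SwapVirialDeficit.BlowUpRing

end
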